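import Literature.AlgebraicGeometry.AbelianSchemes.TupleIsoAtOfFibreIso
import HarnessLib

/-!
# TUPLE-ISO OF FIBRE ISO — the opposite orientation, and the level clause in the POINT currency `σᵃ(x) ∈ A_x(k)` (part 3∕3)

Topic `AlgebraicGeometry/AbelianSchemes`; namespace `Literature.AlgebraicGeometry.AbelianSchemes.AbelianSchemeOver`.  THEOREMS ONLY
(no def, no instance, no notation, no named fact, no `sorry`).  Cell hodgecm-mathlib (D-0151), P6 «MOD programme», sub-desk P6a,
brick (T) of the `stub_HFROB` junction, part 3∕3 (A-p03 (g30), 2026-09-01); parts 1∕2: ★ `AbelianSchemeDualTransportDualIsogeny`,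
★ `TupleIsoAtOfFibreIso` (HEAD `exists_tupleRel_baseChange_comp_of_iso`: an isomorphism of the ITERATED pull-backs
`(𝒜 ×_Y Y₀) ×_{Y₀} xᵢ`, exact on `λ` in dual-homomorphism form, on the level SECTIONS and on the `𝒪`-action, is an isomorphism
of [MumfordFogartyKirwan1994] Def. 7.2 triples between the SINGLE pull-backs `𝒜 ×_Y (xᵢ ≫ π)` — the body of the P6a moduli
datum՚s `tupleIsoAt`).  HC_CM is proved only modulo the printed citations until rung 0 closes; nothing here is about HC.

* §6 `inv_comp_lam_comp_dualIsogenyOver_inv_of_eq` — exactness on `λ` inverts along `e⁻¹` (`(e⁻¹ ≫ e)^∨ = 𝟙`, [MumfordAV1970]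
  §15 Thm. 1); **`exists_tupleRel_baseChange_comp_of_iso_symm`** — the head for an isomorphism pointing the OTHER way
  (`e : (…)_{x₂} ≅ (…)_{x₁}`, `e ≫ λ₁ ≫ e^∨ = λ₂`, `σ₂ᵢ ≫ e = σ₁ᵢ`): the orientation in which a Frobenius ∕ roof computation
  delivers `f : A_{x̄′} ≅ A_{x̄″}` while injectivity consumes `tuple(x̄″) ≅ tuple(x̄′)`.
* §7 over field-valued points `xᵢ : Spec k → Y₀` ([MumfordFogartyKirwan1994] Def. 7.1 «the images `σᵢ(s)`»):
  `sectionBaseChange_left_eq_restrictPt_left` (`σ ×_{Y₀} x` and `σ(x)` ★ `restrictPt` have the same underlying morphism),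
  `sectionPow_single_of_pow_eq_one` (`σ^{δᵢ} = σᵢ` on ANY group scheme, every `N`), `baseChange_σ_comp_eq_of_map_restrictPt_section_eq`
  (level POINTS `σᵃ(x₁) ↦ σᵃ(x₂)` for all `a` ⟹ level SECTIONS `σᵢ ×_{Y₀} x₁ ↦ σᵢ ×_{Y₀} x₂`), and the heads
  **`exists_tupleRel_baseChange_comp_of_iso_of_points`** ∕ **`…_symm_of_points`** with (lvl) read on `restrictPt xᵢ (section_ a)`
  — the `lvlPt₀Of` currency of the P6a moduli datum, so that `tupleIsoAt (spPt x̄₁) (spPt x̄₂) univ act dual pol lvl` is ONE TERM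
  from an isomorphism `sch₀Of x̄₁ ≅ sch₀Of x̄₂` (either orientation) exact on `pol₀Of`, `act₀Of`, `lvlPt₀Of` (junction cert in HOME).

## References
* [MumfordFogartyKirwan1994] D. Mumford, J. Fogarty, F. Kirwan, *Geometric Invariant Theory*, 3rd ed. (1994), Ch. 7 §2 Def. 7.1
  (p. 129), Def. 7.2 (p. 129), Def. 7.3 (p. 130).
* [MumfordAV1970] D. Mumford, *Abelian Varieties* (1970), §15 Thm. 1 (p. 143).
* [MilneAV2008] J. S. Milne, *Abelian Varieties* (2008), I §9 Thm. 9.1 (p. 42).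
* [GortzWedhorn2020] U. Görtz, T. Wedhorn, *Algebraic Geometry I*, 2nd ed. (2020), Section (4.7) (pp. 107–108).
-/

set_option autoImplicit false

noncomputable section

universe u

open CategoryTheory CategoryTheory.Limits AlgebraicGeometry MonoidalCategory
open scoped MonObj

namespace Literature.AlgebraicGeometry.AbelianSchemes

namespace AbelianSchemeOver

open Literature.AlgebraicGeometry.Motives (AlgPoints)

/-! ### §6 Inverting the exactness clauses along `e⁻¹`; the head in the opposite orientation -/

section Symm

variable {T : Scheme.{u}} [IsReduced T] [IsLocallyNoetherian T] {A₁ A₂ : AbelianSchemeOver T}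
  (D₁ : A₁.DualPair) (D₂ : A₂.DualPair) (lam₁ : A₁.X ⟶ D₁.hat.X) (lam₂ : A₂.X ⟶ D₂.hat.X)
  (hD₂ : Nonempty ((Scheme.Modules.pullback (DualPair.unitHatSlice D₂)).obj D₂.P ≅ SheafOfModules.unit _))
  (e : A₁.X ≅ A₂.X) [IsMonHom e.hom]

include hD₂ in
/-- **Exactness on `λ` inverts along `e⁻¹`**: `e ≫ λ₂ ≫ e^∨ = λ₁ ⟹ e⁻¹ ≫ λ₁ ≫ (e⁻¹)^∨ = λ₂` (functoriality
`e^∨ ≫ (e⁻¹)^∨ = (e⁻¹ ≫ e)^∨ = 𝟙^∨ = 𝟙`, ★ `dualIsogenyOver_comp` ∕ `dualIsogenyOver_id'`; `𝒫₂|_{A₂ × {ε}} ≅ 𝒪`). [cite: MumfordAV1970, §15 Thm. 1 (p. 143)]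
[cite: MilneAV2008, I §9 Thm. 9.1 (p. 42)] -/
theorem inv_comp_lam_comp_dualIsogenyOver_inv_of_eq (h : e.hom ≫ lam₂ ≫ DualPair.dualIsogenyOver e.hom D₁ D₂ = lam₁) :
    e.inv ≫ lam₁ ≫ DualPair.dualIsogenyOver e.inv D₂ D₁ = lam₂ := by
  rw [← h, Category.assoc, Category.assoc, ← DualPair.dualIsogenyOver_comp e.inv e.hom D₂ D₁ D₂,
    DualPair.dualIsogenyOver_congr D₂ D₂ (ψ₂ := 𝟙 A₂.X) (h₂ := inferInstance) e.inv_hom_id,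
    DualPair.dualIsogenyOver_id' D₂ hD₂, Category.comp_id, e.inv_hom_id_assoc]

end Symm

section HeadSymm

variable {Y Y₀ T : Scheme.{u}} [IsReduced T] [IsLocallyNoetherian T] [PreconnectedSpace T]
  (𝒜 : AbelianSchemeOver Y) {O : Type*} [CommRing O] (ρ : RingAction O 𝒜) (D : 𝒜.DualPair) (pol : 𝒜.Polarization D)
  {g N : ℕ} (lvl : 𝒜.LevelStructure g N) (π : Y₀ ⟶ Y) (x₁ x₂ : T ⟶ Y₀)

/-- **TUPLE-ISO OF FIBRE ISO, opposite orientation**: the same conclusion (an isomorphism of triples FROM the pull-back at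
`x₁ ≫ π` TO the one at `x₂ ≫ π`) from an isomorphism `e : (𝒜 ×_Y Y₀)_{x₂} ≅ (𝒜 ×_Y Y₀)_{x₁}` pointing the OTHER way, exact on
`λ` (`e ≫ λ₁ ≫ e^∨ = λ₂`), level (`σ₂ᵢ ≫ e = σ₁ᵢ`) and `ι` — the orientation in which a Frobenius∕roof computation delivers
`f : A_{x̄′} ≅ A_{x̄″}` while injectivity is consumed as `tuple(x̄″) ≅ tuple(x̄′)` (apply the head to `e⁻¹`; §6 inverts the
clauses). [cite: MumfordFogartyKirwan1994, Ch. 7 §2 Definition 7.2 (p. 129) and Definition 7.3 (p. 130)]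
[cite: GortzWedhorn2020, Section (4.7) (pp. 107–108)] -/
theorem exists_tupleRel_baseChange_comp_of_iso_symm
    (e : ((𝒜.baseChange π).baseChange x₂).X ≅ ((𝒜.baseChange π).baseChange x₁).X) [IsMonHom e.hom]
    (hlam : e.hom ≫ ((pol.baseChange π).baseChange x₁).lam ≫
        DualPair.dualIsogenyOver e.hom ((D.baseChange π).baseChange x₂) ((D.baseChange π).baseChange x₁) =
      ((pol.baseChange π).baseChange x₂).lam)
    (hσ : ∀ i, ((lvl.baseChange π).baseChange x₂).σ i ≫ e.hom = ((lvl.baseChange π).baseChange x₁).σ i)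
    (hact : ∀ a, baseChangeHom (baseChangeHom (ρ.i a) π) x₂ ≫ e.hom = e.hom ≫ baseChangeHom (baseChangeHom (ρ.i a) π) x₁) :
    ∃ (G : (𝒜.baseChange (x₁ ≫ π)).X.left ⟶ (𝒜.baseChange (x₂ ≫ π)).X.left)
      (Ĝ : (D.baseChange (x₁ ≫ π)).hat.X.left ⟶ (D.baseChange (x₂ ≫ π)).hat.X.left),
      (lvl.baseChange (x₁ ≫ π)).IsBaseChangeVia (lvl.baseChange (x₂ ≫ π)) (𝟙 T) G ∧
      (D.baseChange (x₁ ≫ π)).hat.IsBaseChangeVia (D.baseChange (x₂ ≫ π)).hat (𝟙 T) Ĝ ∧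
      (∃ (wG : (𝒜.baseChange (x₁ ≫ π)).X.hom ≫ 𝟙 T = G ≫ (𝒜.baseChange (x₂ ≫ π)).X.hom)
          (wĜ : (D.baseChange (x₁ ≫ π)).hat.X.hom ≫ 𝟙 T = Ĝ ≫ (D.baseChange (x₂ ≫ π)).hat.X.hom),
        Nonempty ((Scheme.Modules.pullback
          (pullback.map (𝒜.baseChange (x₁ ≫ π)).X.hom (D.baseChange (x₁ ≫ π)).hat.X.hom
            (𝒜.baseChange (x₂ ≫ π)).X.hom (D.baseChange (x₂ ≫ π)).hat.X.hom G Ĝ (𝟙 T) wG wĜ)).obj (D.baseChange (x₂ ≫ π)).P ≅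
          (D.baseChange (x₁ ≫ π)).P)) ∧
      (pol.baseChange (x₁ ≫ π)).lam.left ≫ Ĝ = G ≫ (pol.baseChange (x₂ ≫ π)).lam.left ∧
      ∀ a : O, (baseChangeHom (ρ.i a) (x₁ ≫ π)).left ≫ G = G ≫ (baseChangeHom (ρ.i a) (x₂ ≫ π)).left := by
  haveI : IsMonHom e.symm.hom := (inferInstance : IsMonHom e.inv)
  haveI := ((pol.baseChange π).baseChange x₁).isMonHom
  refine exists_tupleRel_baseChange_comp_of_iso 𝒜 ρ D pol lvl π x₁ x₂ e.symm ?_ (fun i => ?_) (fun a => ?_)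
  · exact inv_comp_lam_comp_dualIsogenyOver_inv_of_eq _ _ _ _ ((pol.baseChange π).baseChange x₁).nonempty_unitHatSlice_iso e
      hlam
  · rw [Iso.symm_hom, ← hσ i, Category.assoc, e.hom_inv_id, Category.comp_id]
  · rw [Iso.symm_hom, ← cancel_epi e.hom, ← Category.assoc, ← hact a, Category.assoc, e.hom_inv_id, Category.comp_id,
      e.hom_inv_id_assoc]

end HeadSymm

/-! ### §7 Over a field-valued point: the level clause in the POINT currency `σᵃ(x) ∈ A_x(k)` (★ `restrictPt`, ★ `section_`) -/

section Points

variable {Y₀ : Scheme.{u}} {K : Type u} [Field K] (A : AbelianSchemeOver Y₀)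

/-- The pulled-back section `τ ×_{Y₀} x` of `A ×_{Y₀, x} Spec k` and the point `τ(x)` (★ `restrictPt`) have the same underlying
morphism `Spec k → A ×_{Y₀} Spec k` (both are `(x ≫ τ, 𝟙)`). [cite: MumfordFogartyKirwan1994, Ch. 7 §2 Definition 7.1 (p. 129)] -/
theorem sectionBaseChange_left_eq_restrictPt_left (x : Spec (.of K) ⟶ Y₀) (τ : A.Sections) :
    (A.sectionBaseChange x τ).left = (A.restrictPt x τ).left := by
  apply pullback.hom_ext
  · exact (A.sectionBaseChange_left_comp_fst x τ).trans (A.restrictPt_left_fst x τ).symm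
  · exact (Over.w (A.sectionBaseChange x τ)).trans (A.restrictPt_left_snd x τ).symm

omit [Field K] in
/-- `σ^{δᵢ} = σᵢ` for `N`-torsion sections — on ANY group scheme (no commutativity: all factors of the ordered product but one
are `1`) and for every `N` (at `N = 1` both sides are `1`). [cite: MumfordFogartyKirwan1994, Ch. 7 §2 Definition 7.1 (p. 129)] -/
theorem sectionPow_single_of_pow_eq_one {g N : ℕ} {σ : Fin g ⊕ Fin g → A.Sections} (hσ : ∀ k, σ k ^ N = 1)
    (i : Fin g ⊕ Fin g) : A.sectionPow σ (Pi.single i 1 : Fin g ⊕ Fin g → ZMod N) = σ i := by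
  -- the distinguished exponent `(1 : ℤ∕N).val = 1 % N`
  have hone : ∀ k, σ k ^ (1 : ZMod N).val = σ k := fun k => by
    rw [ZMod.val_one_eq_one_mod]
    by_cases hN : N = 1
    · subst hN
      have h1 : σ k = 1 := by simpa using hσ k
      rw [h1, one_pow]
    · rw [Nat.one_mod_eq_one.mpr hN, pow_one]
  -- an ordered product over `Fin g` whose factors are `1` off one index
  have hprod : ∀ (f : Fin g → A.Sections) (j₀ : Fin g), (∀ j, j ≠ j₀ → f j = 1) → (List.ofFn f).prod = f j₀ :=
    fun f j₀ hf => by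
      rw [List.ofFn_eq_map, List.prod_map_eq_pow_single j₀ f fun j hj _ => hf j hj,
        List.count_eq_one_of_mem (List.nodup_finRange g) (List.mem_finRange j₀), pow_one]
  have hprod1 : ∀ (f : Fin g → A.Sections), (∀ j, f j = 1) → (List.ofFn f).prod = 1 :=
    fun f hf => List.prod_eq_one (List.forall_mem_ofFn_iff.mpr hf)
  rcases i with i₀ | i₀
  · rw [sectionPow, hprod _ i₀ fun j hj => by rw [Pi.single_eq_of_ne (fun h => hj (Sum.inl_injective h)), ZMod.val_zero,
        pow_zero], hprod1 _ fun j => by rw [Pi.single_eq_of_ne Sum.inr_ne_inl, ZMod.val_zero, pow_zero], mul_one,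
      Pi.single_eq_same, hone]
  · rw [sectionPow, hprod1 _ fun j => by rw [Pi.single_eq_of_ne Sum.inl_ne_inr, ZMod.val_zero, pow_zero],
      hprod _ i₀ fun j hj => by rw [Pi.single_eq_of_ne (fun h => hj (Sum.inr_injective h)), ZMod.val_zero, pow_zero],
      one_mul, Pi.single_eq_same, hone]

/-- **From level POINTS to level SECTIONS**: if a morphism `f : A_{x₁} → A_{x₂}` over `Spec k` carries the points `σᵃ(x₁)`
to `σᵃ(x₂)` for all `a ∈ (ℤ∕n)^{2g}` (★ `restrictPt` of ★ `section_`), it carries the pulled-back basis SECTIONS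
`σᵢ ×_{Y₀} x₁` to `σᵢ ×_{Y₀} x₂` (take `a = δᵢ`). [cite: MumfordFogartyKirwan1994, Ch. 7 §2 Definition 7.1 (p. 129)] -/
theorem baseChange_σ_comp_eq_of_map_restrictPt_section_eq {g n : ℕ} (φ : A.LevelStructure g n)
    (x₁ x₂ : Spec (.of K) ⟶ Y₀) (f : (A.baseChange x₁).X ⟶ (A.baseChange x₂).X)
    (h : ∀ a, AlgPoints.map f (A.restrictPt x₁ (φ.section_ a)) = A.restrictPt x₂ (φ.section_ a)) (i : Fin g ⊕ Fin g) :
    (φ.baseChange x₁).σ i ≫ f = (φ.baseChange x₂).σ i := by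
  have hi : φ.σ i = φ.section_ (Pi.single i 1) := (A.sectionPow_single_of_pow_eq_one φ.pow_σ i).symm
  have h1 : (A.restrictPt x₁ (φ.section_ (Pi.single i 1))).left ≫ f.left =
      (A.restrictPt x₂ (φ.section_ (Pi.single i 1))).left :=
    congrArg CommaMorphism.left (h (Pi.single i 1))
  apply Over.OverMorphism.ext
  rw [Over.comp_left, LevelStructure.baseChange_σ, LevelStructure.baseChange_σ, sectionBaseChange_left_eq_restrictPt_left,
    sectionBaseChange_left_eq_restrictPt_left, hi]
  exact h1

end Points

section HeadPoints

variable {Y Y₀ : Scheme.{u}} {K : Type u} [Field K]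
  (𝒜 : AbelianSchemeOver Y) {O : Type*} [CommRing O] (ρ : RingAction O 𝒜) (D : 𝒜.DualPair) (pol : 𝒜.Polarization D)
  {g N : ℕ} (lvl : 𝒜.LevelStructure g N) (π : Y₀ ⟶ Y) (x₁ x₂ : Spec (.of K) ⟶ Y₀)

/-- **TUPLE-ISO OF FIBRE ISO at two `k`-points, level clause in POINT currency** (the shape of the P6a moduli datum's
`tupleIsoAt (spPt x̄₁) (spPt x̄₂) univ act dual pol lvl` from an isomorphism of the special fibres `sch₀Of x̄₁ ≅ sch₀Of x̄₂` exact on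
`pol₀Of` (dual-homomorphism form), on `act₀Of` and on the level points `lvlPt₀Of`): as ★ `exists_tupleRel_baseChange_comp_of_iso`,
with (lvl) read on the points `σᵃ(xᵢ) ∈ A_{xᵢ}(k)`. [cite: MumfordFogartyKirwan1994, Ch. 7 §2 Definition 7.2 (p. 129) and Definition 7.3 (p. 130)]
[cite: GortzWedhorn2020, Section (4.7) (pp. 107–108)] -/
theorem exists_tupleRel_baseChange_comp_of_iso_of_points
    (e : ((𝒜.baseChange π).baseChange x₁).X ≅ ((𝒜.baseChange π).baseChange x₂).X) [IsMonHom e.hom]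
    (hlam : e.hom ≫ ((pol.baseChange π).baseChange x₂).lam ≫
        DualPair.dualIsogenyOver e.hom ((D.baseChange π).baseChange x₁) ((D.baseChange π).baseChange x₂) =
      ((pol.baseChange π).baseChange x₁).lam)
    (hlvl : ∀ a, AlgPoints.map e.hom ((𝒜.baseChange π).restrictPt x₁ ((lvl.baseChange π).section_ a)) =
      (𝒜.baseChange π).restrictPt x₂ ((lvl.baseChange π).section_ a))
    (hact : ∀ a, baseChangeHom (baseChangeHom (ρ.i a) π) x₁ ≫ e.hom = e.hom ≫ baseChangeHom (baseChangeHom (ρ.i a) π) x₂) :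
    ∃ (G : (𝒜.baseChange (x₁ ≫ π)).X.left ⟶ (𝒜.baseChange (x₂ ≫ π)).X.left)
      (Ĝ : (D.baseChange (x₁ ≫ π)).hat.X.left ⟶ (D.baseChange (x₂ ≫ π)).hat.X.left),
      (lvl.baseChange (x₁ ≫ π)).IsBaseChangeVia (lvl.baseChange (x₂ ≫ π)) (𝟙 _) G ∧
      (D.baseChange (x₁ ≫ π)).hat.IsBaseChangeVia (D.baseChange (x₂ ≫ π)).hat (𝟙 _) Ĝ ∧
      (∃ (wG : (𝒜.baseChange (x₁ ≫ π)).X.hom ≫ 𝟙 _ = G ≫ (𝒜.baseChange (x₂ ≫ π)).X.hom)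
          (wĜ : (D.baseChange (x₁ ≫ π)).hat.X.hom ≫ 𝟙 _ = Ĝ ≫ (D.baseChange (x₂ ≫ π)).hat.X.hom),
        Nonempty ((Scheme.Modules.pullback
          (pullback.map (𝒜.baseChange (x₁ ≫ π)).X.hom (D.baseChange (x₁ ≫ π)).hat.X.hom
            (𝒜.baseChange (x₂ ≫ π)).X.hom (D.baseChange (x₂ ≫ π)).hat.X.hom G Ĝ (𝟙 _) wG wĜ)).obj (D.baseChange (x₂ ≫ π)).P ≅
          (D.baseChange (x₁ ≫ π)).P)) ∧
      (pol.baseChange (x₁ ≫ π)).lam.left ≫ Ĝ = G ≫ (pol.baseChange (x₂ ≫ π)).lam.left ∧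
      ∀ a : O, (baseChangeHom (ρ.i a) (x₁ ≫ π)).left ≫ G = G ≫ (baseChangeHom (ρ.i a) (x₂ ≫ π)).left :=
  exists_tupleRel_baseChange_comp_of_iso 𝒜 ρ D pol lvl π x₁ x₂ e hlam
    (baseChange_σ_comp_eq_of_map_restrictPt_section_eq (𝒜.baseChange π) (lvl.baseChange π) x₁ x₂ e.hom hlvl) hact

/-- **The same, opposite orientation, POINT currency** (`e : (𝒜 ×_Y Y₀)_{x₂} ≅ (𝒜 ×_Y Y₀)_{x₁}` carrying `σᵃ(x₂)` to `σᵃ(x₁)`).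
[cite: MumfordFogartyKirwan1994, Ch. 7 §2 Definition 7.2 (p. 129) and Definition 7.3 (p. 130)] [cite: GortzWedhorn2020, Section (4.7) (pp. 107–108)] -/
theorem exists_tupleRel_baseChange_comp_of_iso_symm_of_points
    (e : ((𝒜.baseChange π).baseChange x₂).X ≅ ((𝒜.baseChange π).baseChange x₁).X) [IsMonHom e.hom]
    (hlam : e.hom ≫ ((pol.baseChange π).baseChange x₁).lam ≫
        DualPair.dualIsogenyOver e.hom ((D.baseChange π).baseChange x₂) ((D.baseChange π).baseChange x₁) =
      ((pol.baseChange π).baseChange x₂).lam)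
    (hlvl : ∀ a, AlgPoints.map e.hom ((𝒜.baseChange π).restrictPt x₂ ((lvl.baseChange π).section_ a)) =
      (𝒜.baseChange π).restrictPt x₁ ((lvl.baseChange π).section_ a))
    (hact : ∀ a, baseChangeHom (baseChangeHom (ρ.i a) π) x₂ ≫ e.hom = e.hom ≫ baseChangeHom (baseChangeHom (ρ.i a) π) x₁) :
    ∃ (G : (𝒜.baseChange (x₁ ≫ π)).X.left ⟶ (𝒜.baseChange (x₂ ≫ π)).X.left)
      (Ĝ : (D.baseChange (x₁ ≫ π)).hat.X.left ⟶ (D.baseChange (x₂ ≫ π)).hat.X.left),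
      (lvl.baseChange (x₁ ≫ π)).IsBaseChangeVia (lvl.baseChange (x₂ ≫ π)) (𝟙 _) G ∧
      (D.baseChange (x₁ ≫ π)).hat.IsBaseChangeVia (D.baseChange (x₂ ≫ π)).hat (𝟙 _) Ĝ ∧
      (∃ (wG : (𝒜.baseChange (x₁ ≫ π)).X.hom ≫ 𝟙 _ = G ≫ (𝒜.baseChange (x₂ ≫ π)).X.hom)
          (wĜ : (D.baseChange (x₁ ≫ π)).hat.X.hom ≫ 𝟙 _ = Ĝ ≫ (D.baseChange (x₂ ≫ π)).hat.X.hom),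
        Nonempty ((Scheme.Modules.pullback
          (pullback.map (𝒜.baseChange (x₁ ≫ π)).X.hom (D.baseChange (x₁ ≫ π)).hat.X.hom
            (𝒜.baseChange (x₂ ≫ π)).X.hom (D.baseChange (x₂ ≫ π)).hat.X.hom G Ĝ (𝟙 _) wG wĜ)).obj (D.baseChange (x₂ ≫ π)).P ≅
          (D.baseChange (x₁ ≫ π)).P)) ∧
      (pol.baseChange (x₁ ≫ π)).lam.left ≫ Ĝ = G ≫ (pol.baseChange (x₂ ≫ π)).lam.left ∧
      ∀ a : O, (baseChangeHom (ρ.i a) (x₁ ≫ π)).left ≫ G = G ≫ (baseChangeHom (ρ.i a) (x₂ ≫ π)).left :=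
  exists_tupleRel_baseChange_comp_of_iso_symm 𝒜 ρ D pol lvl π x₁ x₂ e hlam
    (baseChange_σ_comp_eq_of_map_restrictPt_section_eq (𝒜.baseChange π) (lvl.baseChange π) x₂ x₁ e.hom hlvl) hact

end HeadPoints

end AbelianSchemeOver

end Literature.AlgebraicGeometry.AbelianSchemes

end
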